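import Summits.BirchSwinnertonDyer.BirchSwinnertonDyer.Theorems.PrintCf2RubinValueTwoLinePushSpecialisation
import Summits.BirchSwinnertonDyer.BirchSwinnertonDyer.Theorems.SignedBaseChangeAnticyclotomicEisensteinDivisibilitySpecializationHerbrand
import HarnessLib

/-!
# Crux `PrintCf2.SplitBadTwoRankOneOfFacts` (stmt-BirchSwinnertonDyer-20368), S3n′-FACT-FREE road, brick R4 (first half):
# the (SP)∘(RES) specialisation of S3b′ with `T₁`-REGULARITY (REG) in place of S3n′

Cell `bsd-print-cf2`, WIDTH seat `bsd-line-cf2-p1-w2` g14 (prover-bsd-line-cf2-p1-w2-g14-0); `--supports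
stmt-BirchSwinnertonDyer-20368` (helper, Theses-free). HONEST FRAMING: nothing here closes the crux or a registered stub;
BSD is not proved by any of this; no summit statement is proved by this seat. No definition, no named fact, no `sorry`.

WHY (memo `Cruxes/SplitBadTwoRankOneOfFacts/S3N-FACTFREE-w2g14.md`, OFFER to the LEAD: replace S3b′'s antecedent S3n′ by (REG)). In the
S3b′-v12 chain (cf2c-w3 g2 p689406 `RubinValueTwoV12.restrictedMainConj_two_v12_of_DGal`) the stub S3n′ enters at exactly ONE point:
cf2c-w8 g2's `LineTorsionRegularity.charIdeal_eq_map_constantCoeff_of_linePush` calls -w5 g4's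
`map_constantCoeff_charIdeal_eq_of_pseudoNull_finite (hs) (hfin)` (Herbrand with junk factor `ch(X[T₁]) = 1` because `X[T₁]` is finite).
-w4 g10's `TwoVar.map_constantCoeff_charIdeal_eq (hs) (hX)` gives the same identity from `hX : X[T₁] = 0` (T₁-REGULARITY) instead.
This file is the `_of_XRegular` twin of the three specialisation theorems of cf2c-w8 g2 / cf2c-w2 g2 (p688008, p688471, p687583):
* `charIdeal_eq_map_constantCoeff_of_linePush_of_XRegular` — generic: `f : X ⧸ T₁X ↪ Y` with finite cokernel, `Y` torsion, `X[T₁] = 0` ⟹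
  `charIdeal Λ Y = (charIdeal Λ₂ X).map constantCoeff`;
* `charIdeal_unr_eq_map_constantCoeff_of_inf_inertia_le_of_XRegular`, `charIdeal_unr_eq_map_constantCoeff_of_frame_of_XRegular`,
  **`exists_charGenerator_unr_of_frame_of_XRegular`** — the line / frame forms, binder-identical to `LinePush.…` with
  `(hfin : ∀ N, IsPseudoNull N → Finite N)` replaced by `(hX : ∀ x : D₂.X, PowerSeries.X • x = 0 → x = 0)`.
The (REG) input is what the fact-free road delivers (`KummerProNull.X_regular_two_of_lineLift (hB)`, p697156, modulo the lift (B) — for the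
`A_θ`-datum; its transport to the pinned `W*`-datum `D₂` along the (TW) twist is the second half of R4, memo §8).
beyond-print theorem: no. presearch: memo §5.

References: C. Skinner, E. Urban, Invent. Math. 195 (2014) Cor. 3.2.9 (ii); R. Greenberg, Springer PROMS 188 (2016) Prop. 4.1.1;
R. Greenberg, V. Vatsal, Invent. Math. 142 (2000) §2; A. Agboola, Compos. Math. 143 (2007) §4–§5.
-/

noncomputable section

set_option linter.dupNamespace false
set_option autoImplicit false

open scoped Classical Pointwise
open Function
open NumberField IsDedekindDomain Field WeierstrassCurve
open Literature.NumberTheory.EllipticCurves Literature.NumberTheory.EllipticCurves.GreenbergSelmer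
open Literature.NumberTheory.EllipticCurves.GreenbergVatsal2000 Literature.NumberTheory.EllipticCurves.KellerYin2024
open Literature.NumberTheory.EllipticCurves.IwasawaDual Literature.NumberTheory.EllipticCurves.Module
open Literature.NumberTheory.GaloisRepresentations
open Summit.BirchSwinnertonDyer.BirchSwinnertonDyer.Theorems.IwasawaTwoVariable
open Summit.BirchSwinnertonDyer.BirchSwinnertonDyer.Theorems.PrintCf2.RestrictedSelmerPair
open Summit.BirchSwinnertonDyer.BirchSwinnertonDyer.Theorems.PrintCf2.LineTorsionRegularity
open Summit.BirchSwinnertonDyer.BirchSwinnertonDyer.Theorems.PrintCf2.LinePush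
open Summit.BirchSwinnertonDyer.BirchSwinnertonDyer.Theorems.SignedBaseChangeAcDivSpecialization

universe u

namespace Summit.BirchSwinnertonDyer.BirchSwinnertonDyer.Theorems.PrintCf2.LinePushXReg

/-! ## §1. Generic: specialisation along an exact line push with `X[T₁] = 0` -/

section Generic

variable (p : ℕ) [Fact p.Prime] (X : Type*) [AddCommGroup X] [Module (IwasawaAlgebra₂ p) X] [Module.Finite (IwasawaAlgebra₂ p) X]
  {Y : Type*} [AddCommGroup Y] [Module (IwasawaAlgebra p) Y]

/-- **(SP)∘(RES) with (REG).** For `X` finitely generated over `Λ₂ = Λ⟦T₁⟧` with `X[T₁] = 0`, and `f : X ⧸ T₁X →ₗ[Λ] Y` injective with finite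
cokernel: if `Y` is `Λ`-torsion then `charIdeal Λ Y = (charIdeal Λ₂ X).map constantCoeff` (`hs` from torsion by
`exists_constantCoeff_ne_zero_of_linePush`; Herbrand WITHOUT junk factor by `TwoVar.map_constantCoeff_charIdeal_eq`; pseudo-isomorphism).
[cite: SkinnerUrban2014, Cor. 3.2.9 (ii)] [cite: Greenberg2016, Prop. 4.1.1] -/
theorem charIdeal_eq_map_constantCoeff_of_linePush_of_XRegular
    (f : letI : Module (IwasawaAlgebra p) (QuotSMulTop (PowerSeries.X : IwasawaAlgebra₂ p) X) :=
        Module.compHom _ (PowerSeries.C (R := IwasawaAlgebra p))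
      QuotSMulTop (PowerSeries.X : IwasawaAlgebra₂ p) X →ₗ[IwasawaAlgebra p] Y)
    (hf : Function.Injective f)
    (hcoker : letI : Module (IwasawaAlgebra p) (QuotSMulTop (PowerSeries.X : IwasawaAlgebra₂ p) X) :=
        Module.compHom _ (PowerSeries.C (R := IwasawaAlgebra p))
      Finite (Y ⧸ LinearMap.range f))
    (htor : Module.IsTorsion (IwasawaAlgebra p) Y)
    (hX : ∀ x : X, (PowerSeries.X : IwasawaAlgebra₂ p) • x = 0 → x = 0) :
    charIdeal (IwasawaAlgebra p) Y = (charIdeal (IwasawaAlgebra₂ p) X).map (PowerSeries.constantCoeff (R := IwasawaAlgebra p)) := by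
  letI : Module (IwasawaAlgebra p) (QuotSMulTop (PowerSeries.X : IwasawaAlgebra₂ p) X) :=
    Module.compHom _ (PowerSeries.C (R := IwasawaAlgebra p))
  have hs := exists_constantCoeff_ne_zero_of_linePush p X f hf htor
  have hsp := TwoVar.map_constantCoeff_charIdeal_eq p X hs hX
  haveI := hcoker
  rw [hsp]
  exact (charIdeal_eq_of_injective_of_finite_quotient_range p f hf).symm

end Generic

/-! ## §2. On the line and on the frame -/

section Line

variable {K : Type u} [Field K] [NumberField K] {p : ℕ} [Fact p.Prime] {κ₁ κ₂ : ZpExtension K p}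
  {M : Type u} [AddCommGroup M] [DistribMulAction (absoluteGaloisGroup K) M] [TopologicalSpace M] [DiscreteTopology M]
  {vbar : HeightOneSpectrum (𝓞 K)} {γ₁ γ₂ : absoluteGaloisGroup K}

/-- **(SP)∘(RES) on the line, with (REG)**: binder-identical to `LinePush.charIdeal_unr_eq_map_constantCoeff_of_inf_inertia_le` except that S3n′
(`hfin`) is replaced by `T₁`-regularity `hX`. [cite: SkinnerUrban2014, Cor. 3.2.9 (ii)] [cite: GreenbergVatsal2000, §2 pp. 17–21] -/
theorem charIdeal_unr_eq_map_constantCoeff_of_inf_inertia_le_of_XRegular (hγ : ZpExtension.IsTopGeneratorPair κ₁ κ₂ γ₁ γ₂)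
    (hI : κ₂.kerSubgroup ⊓ inertia vbar ≤ κ₁.kerSubgroup)
    (htor : ∀ m : M, ∃ k : ℕ, p ^ k • m = 0)
    (hstab : ∀ m : M, IsOpen (MulAction.stabilizer (absoluteGaloisGroup K) m : Set (absoluteGaloisGroup K)))
    (hcont : ∀ m : M, Continuous fun g : absoluteGaloisGroup K ↦ g • m)
    [Finite (FixedPoints.addSubgroup (ZpExtension.pairKer κ₁ κ₂) M ⧸ (ResKernel.subOne (ZpExtension.pairKer κ₁ κ₂) M γ₁).range)]
    (D₂ : DualData₂ κ₁ κ₂ M vbar γ₁ γ₂) [Module.Finite (IwasawaAlgebra₂ p) D₂.X]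
    (D : DatumDualData κ₂ γ₂ M (Castella2018.AcSelmer.bdpData M p vbar) ∅)
    (hXtor : Module.IsTorsion (IwasawaAlgebra p) D.X)
    (hX : ∀ x : D₂.X, (PowerSeries.X : IwasawaAlgebra₂ p) • x = 0 → x = 0) :
    Module.charIdeal (IwasawaAlgebra p) D.X =
      (Module.charIdeal (IwasawaAlgebra₂ p) D₂.X).map (PowerSeries.constantCoeff (R := IwasawaAlgebra p)) := by
  letI : Module (IwasawaAlgebra p) (QuotSMulTop (PowerSeries.X : IwasawaAlgebra₂ p) D₂.X) :=
    Module.compHom _ (PowerSeries.C (R := IwasawaAlgebra p))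
  obtain ⟨f, -, hinj, hfinc, -⟩ := exists_linearMap_quotSMulTop_unr_of_inf_inertia_le hγ hI htor hstab hcont D₂ D
  exact charIdeal_eq_map_constantCoeff_of_linePush_of_XRegular p D₂.X f hinj hfinc hXtor hX

end Line

section Frame

variable {K : Type} [Field K] [NumberField K]

/-- **(SP)∘(RES) on every frame, with (REG)**: binder-identical to `LinePush.charIdeal_unr_eq_map_constantCoeff_of_frame`, S3n′ replaced by (REG).
[cite: Agboola2007, §4, Thm. 2] [cite: SkinnerUrban2014, Cor. 3.2.9 (ii)] [cite: GreenbergVatsal2000, §2 pp. 17–21] -/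
theorem charIdeal_unr_eq_map_constantCoeff_of_frame_of_XRegular {d : ℤ} (hd0 : d ≠ 0) (W : WeierstrassCurve ℚ) [W.IsElliptic]
    (C : VariableChange ℚ) (hC : C • W = cm7.quadraticTwist (d : ℚ)) (hK : IsImaginaryQuadratic K)
    (v vbar : HeightOneSpectrum (𝓞 K)) (hv : ((2 : ℕ) : 𝓞 K) ∈ v.asIdeal) (hvbar : ((2 : ℕ) : 𝓞 K) ∈ vbar.asIdeal) (hne : vbar ≠ v)
    (π : (W.baseChange K).endRing) (r : ℤ_[2]) (κ₁ κ₂ : ZpExtension K 2)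
    (hκ₂ : κ₂.IsUnramifiedOutside vbar) {γ₁ γ₂ : absoluteGaloisGroup K} (hγ : ZpExtension.IsTopGeneratorPair κ₁ κ₂ γ₁ γ₂)
    (D₂ : DualData₂ κ₁ κ₂ ↥((W.baseChange K).endEigenPrimaryTorsion 2 π r) vbar γ₁ γ₂) [Module.Finite (IwasawaAlgebra₂ 2) D₂.X]
    (D : DatumDualData κ₂ γ₂ ↥((W.baseChange K).endEigenPrimaryTorsion 2 π r)
      (Castella2018.AcSelmer.bdpData ↥((W.baseChange K).endEigenPrimaryTorsion 2 π r) 2 vbar) ∅)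
    (hXtor : Module.IsTorsion (IwasawaAlgebra 2) D.X)
    (hX : ∀ x : D₂.X, (PowerSeries.X : IwasawaAlgebra₂ 2) • x = 0 → x = 0) :
    Module.charIdeal (IwasawaAlgebra 2) D.X =
      (Module.charIdeal (IwasawaAlgebra₂ 2) D₂.X).map (PowerSeries.constantCoeff (R := IwasawaAlgebra 2)) := by
  haveI hF : Finite (FixedPoints.addSubgroup (ZpExtension.pairKer κ₁ κ₂) ↥((W.baseChange K).endEigenPrimaryTorsion 2 π r)) :=
    finite_fixedPoints_pairKer_of_frame_any hd0 W C hC hK π r κ₁ κ₂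
  haveI : Finite (FixedPoints.addSubgroup (ZpExtension.pairKer κ₁ κ₂) ↥((W.baseChange K).endEigenPrimaryTorsion 2 π r) ⧸
      (ResKernel.subOne (ZpExtension.pairKer κ₁ κ₂) ↥((W.baseChange K).endEigenPrimaryTorsion 2 π r) γ₁).range) := inferInstance
  exact charIdeal_unr_eq_map_constantCoeff_of_inf_inertia_le_of_XRegular hγ
    (kerSubgroup_inf_inertia_le_of_isUnramifiedOutside_of_pair hK hv hvbar hne hγ hκ₂)
    (exists_pow_smul_endEigenPrimaryTorsion_eq_zero (W.baseChange K) 2 π r) (isOpen_stabilizer_endEigenPrimaryTorsion (W.baseChange K) 2 π r)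
    (continuous_smul_endEigenPrimaryTorsion (W.baseChange K) 2 π r) D₂ D hXtor hX

/-- **THE ALGEBRAIC SIDE OF S3b′-v12 ON EVERY FRAME with (REG) in place of S3n′**: binder-identical to `LinePush.exists_charGenerator_unr_of_frame`
with `hfin` replaced by `hX`. [cite: GreenbergLNM1716, §4 Lemma 4.2] [cite: Agboola2007, §4–§5, Thm. 2] [cite: GreenbergVatsal2000, §2 pp. 17–21] -/
theorem exists_charGenerator_unr_of_frame_of_XRegular {d : ℤ} (hd0 : d ≠ 0) (W : WeierstrassCurve ℚ) [W.IsElliptic]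
    (C : VariableChange ℚ) (hC : C • W = cm7.quadraticTwist (d : ℚ)) (hK : IsImaginaryQuadratic K)
    (v vbar : HeightOneSpectrum (𝓞 K)) (hv : ((2 : ℕ) : 𝓞 K) ∈ v.asIdeal) (hvbar : ((2 : ℕ) : 𝓞 K) ∈ vbar.asIdeal) (hne : vbar ≠ v)
    (π : (W.baseChange K).endRing) (r : ℤ_[2]) (κ₁ κ₂ : ZpExtension K 2)
    (hκ₂ : κ₂.IsUnramifiedOutside vbar) {γ₁ γ₂ : absoluteGaloisGroup K} (hγ : ZpExtension.IsTopGeneratorPair κ₁ κ₂ γ₁ γ₂)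
    (D₂ : DualData₂ κ₁ κ₂ ↥((W.baseChange K).endEigenPrimaryTorsion 2 π r) vbar γ₁ γ₂) [Module.Finite (IwasawaAlgebra₂ 2) D₂.X]
    (hX : ∀ x : D₂.X, (PowerSeries.X : IwasawaAlgebra₂ 2) • x = 0 → x = 0)
    (D : DatumDualData κ₂ γ₂ ↥((W.baseChange K).endEigenPrimaryTorsion 2 π r)
      (Castella2018.AcSelmer.bdpData ↥((W.baseChange K).endEigenPrimaryTorsion 2 π r) 2 vbar) ∅)
    (hΓ : Finite (endInvariants (conjUnr κ₂ ↥((W.baseChange K).endEigenPrimaryTorsion 2 π r) vbar (∅ : Set (HeightOneSpectrum (𝓞 K))) γ₂ - 1))) :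
    Module.Finite (IwasawaAlgebra 2) D.X ∧ Module.IsTorsion (IwasawaAlgebra 2) D.X ∧
      ∃ H : IwasawaAlgebra 2, Module.charIdeal (IwasawaAlgebra 2) D.X = Ideal.span {H} ∧ PowerSeries.constantCoeff H ≠ 0 ∧
        Ideal.span {H} = (Module.charIdeal (IwasawaAlgebra₂ 2) D₂.X).map (PowerSeries.constantCoeff (R := IwasawaAlgebra 2)) := by
  obtain ⟨hfg, hXt, H, hH, hH0⟩ := finite_isTorsion_exists_charIdeal_of_finite_endInvariants_unr D
    (exists_pow_smul_endEigenPrimaryTorsion_eq_zero (W.baseChange K) 2 π r) (isOpen_stabilizer_endEigenPrimaryTorsion (W.baseChange K) 2 π r)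
    hγ.2.2.2 hΓ
  refine ⟨hfg, hXt, H, hH, hH0, ?_⟩
  rw [← hH]
  exact charIdeal_unr_eq_map_constantCoeff_of_frame_of_XRegular hd0 W C hC hK v vbar hv hvbar hne π r κ₁ κ₂ hκ₂ hγ D₂ D hXt hX

end Frame

end Summit.BirchSwinnertonDyer.BirchSwinnertonDyer.Theorems.PrintCf2.LinePushXReg

end
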